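import Summits.QuantumFields.BalabanUV.Beta.GAN24.GradientVertexChainKing
import Summits.QuantumFields.BalabanUV.Beta.GAN24.AveragedPropagatorLocality
import Summits.QuantumFields.BalabanUV.Beta.GAN24.MultilinearProlongation

/-!
# `BalabanUV.Beta.GAN24.HkOpBlockProfile` — binder row G-an2-4 ∕ (CONV-C), routes R1 ∕ R6 ∕ R7 at `U = 1`: OSCILLATION OF BAŁABAN's MINIMISER `H_nB` OVER UNIT STEPS,
# STRAIGHT RUNS AND CUBE VERTICES AGAINST THE BLOCK PROFILE `Φ_B(b) := Σ_y e^{−dec|b − y|_T}·Σ_λ|B_λ(y)|` — volume-free, every torus, every `n ≥ 1`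
# (unit b2b-balaban-gan24-p3, gen 49; v1 — the decaying twin of `WhitneyRowDefectBound` §1, input of `WhitneyRowDefectBoundDecay`)

NOT IN PRINT; OUR PROOF ([folklore] finite sums over TREE objects BY NAME: `GradientVertexChainKing.norm_dker_le_block` — b05's `n`-uniform decaying gradient kernel of (1.63)
at an arbitrary fine point —, `AveragedPropagatorLocality.blockOf_add_unitVec` ∕ `exp_tsn_le_of_adj` — a fine unit step moves the block by at most one unit step, adjacent blocks
cost `e^{dec}`).  HONEST FRAMING (cell contract, verbatim): «discharging `BetaPertH` makes Bałaban's UV stability UNCONDITIONAL — a real constructive-QFT result; it is NOT the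
continuum limit and NOT the Clay problem.»  HONEST DEPENDENCY (verbatim): «continuum YM on T⁴ ⇐ BetaPertH ∧ nine spine estimates (0/9 proved); BetaPertH ⇐ (D1) ∧ (D4) ∧
CAP+tail; G-an2-4 gates asym, D1 and NE2/3/4.»
CONTENT (0 sorry, 0 `def`, nothing cited): `norm_HkOp_step_le_decay` (`|(H_nB)_μ(x + e_ν) − (H_nB)_μ(x)| ≤ CdecD∕n·Φ_B(blk x)`), `phi_le_exp_mul_phi_of_adj`,
`phi_blockOf_add_unitVec_le`, `phi_blockOf_add_tstep_le` (`Φ_B(blk(x + c e_ν)) ≤ e^{dec·c}Φ_B(blk x)`), `phi_blockOf_add_vtx_le`, `norm_HkOp_tstep_le_decay`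
(`≤ c·e^{dec·c}·CdecD∕n·Φ_B(blk x)`), `norm_HkOp_vtx_le_decay` (`≤ |T|·e^{dec|T|}·CdecD∕n·Φ_B(blk x)`).  `U = 1`, torus model; NOT (CONV-C), NOT D1, NOT `BetaPertH`,
NOT continuum, NOT Clay; NEVER «G-an2-4 closed».
-/

noncomputable section

namespace Summit.QuantumFields.BalabanUV.Beta.GAN24.HkOpBlockProfile

open Matrix Finset
open scoped BigOperators ComplexOrder
open Literature.MathematicalPhysics.QuantumFieldTheory.Balaban1983to89
open Literature.MathematicalPhysics.QuantumFieldTheory.Balaban1983to89.B5Prop11Plancherel (Tor fine unitVec)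
open Literature.MathematicalPhysics.QuantumFieldTheory.Balaban1983to89.B4TorusKernel.MultiPeriod (torusSupNorm)
open Literature.MathematicalPhysics.QuantumFieldTheory.Balaban1983to89.B5Block118 (tstep tstep_zero tstep_succ)
open Literature.MathematicalPhysics.QuantumFieldTheory.Balaban1983to89.B5Blocks16 (blockOf)
open Literature.MathematicalPhysics.QuantumFieldTheory.Balaban1983to89.B6LowerBound2153Torus (toT rep toT_rep)
open Literature.MathematicalPhysics.QuantumFieldTheory.Balaban1983to89.B5Action121 (fdiff_mulVec_apply sdiff_mulVec comp)
open Literature.MathematicalPhysics.QuantumFieldTheory.Balaban1983to89.B5Hk163Torus (HkOp)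
open Literature.MathematicalPhysics.QuantumFieldTheory.Balaban1983to89.B5Hk163TorusHolder (dker fdiff_HkOp_mulVec)
open Literature.MathematicalPhysics.QuantumFieldTheory.Balaban1983to89.B5Hk163TorusHolderDecay (CdecD CdecD_nonneg)
open Summit.QuantumFields.BalabanUV.Beta.GAN24.MultilinearProlongation (vtx vtx_insert)
open Summit.QuantumFields.BalabanUV.Beta.GAN24.HkKingOneStep (dec dec_pos)
open Summit.QuantumFields.BalabanUV.Beta.GAN24.GradientVertexChainKing (norm_dker_le_block)
open Summit.QuantumFields.BalabanUV.Beta.GAN24.AveragedPropagatorLocality (blockOf_add_unitVec exp_tsn_le_of_adj)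

variable {d : ℕ}

/-! ## §1 Oscillation of Bałaban's minimiser over unit steps against the block profile `Φ_B(b) = Σ_y e^{−dec|b − y|_T}·Σ_λ|B_λ(y)|` -/

section Osc

variable (n : ℕ) [NeZero n] (M : Fin (d + 1) → ℕ) [hM : ∀ μ, NeZero (M μ)]

/-- **ONE UNIT STEP, DECAYING FORM**: `|(H_nB)_μ(x + e_ν) − (H_nB)_μ(x)| ≤ CdecD(d)∕n · Φ_B(blk x)` (`fdiff_HkOp_mulVec` + `norm_dker_le_block`). [folklore] -/
theorem norm_HkOp_step_le_decay (B : Tor M × Fin (d + 1) → ℂ) (x : Tor (fine n M)) (μ ν : Fin (d + 1)) :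
    ‖(HkOp n M *ᵥ B) (x + unitVec (fine n M) ν, μ) - (HkOp n M *ᵥ B) (x, μ)‖
      ≤ CdecD d / n * ∑ y : Tor M, Real.exp (-(dec d * torusSupNorm M (rep M (blockOf n M x) - rep M y))) * ∑ lam : Fin (d + 1), ‖B (y, lam)‖ := by
  have hn : (0 : ℝ) < n := Nat.cast_pos.mpr (Nat.pos_of_ne_zero (NeZero.ne n))
  -- the gradient at `x`
  have h : ‖(B5Prop11Plancherel.fdiff (fine n M) (n : ℂ) ν *ᵥ (HkOp n M *ᵥ B)) (x, μ)‖
      ≤ CdecD d * ∑ y : Tor M, Real.exp (-(dec d * torusSupNorm M (rep M (blockOf n M x) - rep M y))) * ∑ lam : Fin (d + 1), ‖B (y, lam)‖ := by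
    rw [fdiff_HkOp_mulVec, Finset.mul_sum]
    refine (norm_sum_le _ _).trans (Finset.sum_le_sum fun y _ => ?_)
    rw [← mul_assoc, Finset.mul_sum]
    refine (norm_sum_le _ _).trans (Finset.sum_le_sum fun lam _ => ?_)
    rw [norm_mul]
    have hk := norm_dker_le_block n M μ lam ν x (rep M y)
    rw [toT_rep] at hk
    exact mul_le_mul_of_nonneg_right hk (norm_nonneg _)
  rw [fdiff_mulVec_apply, sdiff_mulVec, norm_mul, Complex.norm_natCast] at h
  rw [div_mul_eq_mul_div, le_div_iff₀ hn, mul_comm]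
  exact h

/-- **ADJACENT BLOCKS COST `e^{dec}`** on the block profile: `b′ ∈ {b, b ± e_μ} ⟹ Φ_B(b′) ≤ e^{dec}·Φ_B(b)` (`exp_tsn_le_of_adj` termwise). [folklore] -/
theorem phi_le_exp_mul_phi_of_adj (B : Tor M × Fin (d + 1) → ℂ) (b b' : Tor M) (μ : Fin (d + 1))
    (h : b' = b ∨ b' = b + unitVec M μ ∨ b' = b - unitVec M μ) :
    ∑ y : Tor M, Real.exp (-(dec d * torusSupNorm M (rep M b' - rep M y))) * ∑ lam : Fin (d + 1), ‖B (y, lam)‖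
      ≤ Real.exp (dec d) * ∑ y : Tor M, Real.exp (-(dec d * torusSupNorm M (rep M b - rep M y))) * ∑ lam : Fin (d + 1), ‖B (y, lam)‖ := by
  rw [Finset.mul_sum]
  refine Finset.sum_le_sum fun y _ => ?_
  rw [← mul_assoc]
  exact mul_le_mul_of_nonneg_right (exp_tsn_le_of_adj M (dec_pos d).le b b' y μ h) (Finset.sum_nonneg fun _ _ => norm_nonneg _)

/-- one fine unit step: `Φ_B(blk(x + e_ν)) ≤ e^{dec}·Φ_B(blk x)` (`blockOf_add_unitVec`). [folklore] -/
theorem phi_blockOf_add_unitVec_le (B : Tor M × Fin (d + 1) → ℂ) (x : Tor (fine n M)) (ν : Fin (d + 1)) :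
    ∑ y : Tor M, Real.exp (-(dec d * torusSupNorm M (rep M (blockOf n M (x + unitVec (fine n M) ν)) - rep M y))) * ∑ lam : Fin (d + 1), ‖B (y, lam)‖
      ≤ Real.exp (dec d) * ∑ y : Tor M, Real.exp (-(dec d * torusSupNorm M (rep M (blockOf n M x) - rep M y))) * ∑ lam : Fin (d + 1), ‖B (y, lam)‖ := by
  refine phi_le_exp_mul_phi_of_adj M B _ _ ν ?_
  rcases blockOf_add_unitVec n M x ν with h | h
  · exact Or.inl h
  · exact Or.inr (Or.inl h)

/-- a straight run: `Φ_B(blk(x + c e_ν)) ≤ e^{dec·c}·Φ_B(blk x)`. [folklore] -/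
theorem phi_blockOf_add_tstep_le (B : Tor M × Fin (d + 1) → ℂ) (x : Tor (fine n M)) (ν : Fin (d + 1)) (c : ℕ) :
    ∑ y : Tor M, Real.exp (-(dec d * torusSupNorm M (rep M (blockOf n M (x + tstep (fine n M) ν c)) - rep M y))) * ∑ lam : Fin (d + 1), ‖B (y, lam)‖
      ≤ Real.exp (dec d * c) * ∑ y : Tor M, Real.exp (-(dec d * torusSupNorm M (rep M (blockOf n M x) - rep M y))) * ∑ lam : Fin (d + 1), ‖B (y, lam)‖ := by
  induction c with
  | zero => simp [tstep_zero]
  | succ c ih =>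
      rw [tstep_succ, ← add_assoc]
      refine (phi_blockOf_add_unitVec_le n M B _ ν).trans ?_
      rw [show Real.exp (dec d * ((c + 1 : ℕ) : ℝ)) = Real.exp (dec d) * Real.exp (dec d * c) by rw [← Real.exp_add]; push_cast; ring_nf, mul_assoc]
      exact mul_le_mul_of_nonneg_left ih (Real.exp_pos _).le

/-- a cube vertex: `Φ_B(blk(x + Σ_{μ∈T} e_μ)) ≤ e^{dec·|T|}·Φ_B(blk x)`. [folklore] -/
theorem phi_blockOf_add_vtx_le (B : Tor M × Fin (d + 1) → ℂ) (x : Tor (fine n M)) (T : Finset (Fin (d + 1))) :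
    ∑ y : Tor M, Real.exp (-(dec d * torusSupNorm M (rep M (blockOf n M (x + vtx (fine n M) T)) - rep M y))) * ∑ lam : Fin (d + 1), ‖B (y, lam)‖
      ≤ Real.exp (dec d * T.card) * ∑ y : Tor M, Real.exp (-(dec d * torusSupNorm M (rep M (blockOf n M x) - rep M y))) * ∑ lam : Fin (d + 1), ‖B (y, lam)‖ := by
  induction T using Finset.induction_on with
  | empty => simp [vtx]
  | insert i T hi ih =>
      rw [vtx_insert _ hi, card_insert_of_notMem hi, show x + (unitVec (fine n M) i + vtx (fine n M) T) = x + vtx (fine n M) T + unitVec (fine n M) i by abel]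
      refine (phi_blockOf_add_unitVec_le n M B _ i).trans ?_
      rw [show Real.exp (dec d * ((T.card + 1 : ℕ) : ℝ)) = Real.exp (dec d) * Real.exp (dec d * T.card) by rw [← Real.exp_add]; push_cast; ring_nf, mul_assoc]
      exact mul_le_mul_of_nonneg_left ih (Real.exp_pos _).le

/-- **A STRAIGHT RUN of `c` unit steps, decaying form**: `|(H_nB)_μ(x + c e_ν) − (H_nB)_μ(x)| ≤ c·e^{dec·c}·CdecD∕n·Φ_B(blk x)`. [folklore] -/
theorem norm_HkOp_tstep_le_decay (B : Tor M × Fin (d + 1) → ℂ) (x : Tor (fine n M)) (μ ν : Fin (d + 1)) (c : ℕ) :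
    ‖(HkOp n M *ᵥ B) (x + tstep (fine n M) ν c, μ) - (HkOp n M *ᵥ B) (x, μ)‖
      ≤ c * Real.exp (dec d * c) *
          (CdecD d / n * ∑ y : Tor M, Real.exp (-(dec d * torusSupNorm M (rep M (blockOf n M x) - rep M y))) * ∑ lam : Fin (d + 1), ‖B (y, lam)‖) := by
  set Φ := ∑ y : Tor M, Real.exp (-(dec d * torusSupNorm M (rep M (blockOf n M x) - rep M y))) * ∑ lam : Fin (d + 1), ‖B (y, lam)‖ with hΦ
  have hK : 0 ≤ CdecD d / n := div_nonneg CdecD_nonneg (Nat.cast_nonneg _)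
  have hΦ0 : 0 ≤ Φ := Finset.sum_nonneg fun y _ => mul_nonneg (Real.exp_pos _).le (Finset.sum_nonneg fun _ _ => norm_nonneg _)
  induction c with
  | zero => simp [tstep_zero]
  | succ c ih =>
      rw [tstep_succ, ← add_assoc]
      have hstep := norm_HkOp_step_le_decay n M B (x + tstep (fine n M) ν c) μ ν
      have hphi := phi_blockOf_add_tstep_le n M B x ν c
      have hec : Real.exp (dec d * c) ≤ Real.exp (dec d * ((c : ℝ) + 1)) :=
        Real.exp_le_exp.mpr (mul_le_mul_of_nonneg_left (by linarith) (dec_pos d).le)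
      have he0 : 0 ≤ Real.exp (dec d * c) := (Real.exp_pos _).le
      calc ‖(HkOp n M *ᵥ B) (x + tstep (fine n M) ν c + unitVec (fine n M) ν, μ) - (HkOp n M *ᵥ B) (x, μ)‖
          ≤ ‖(HkOp n M *ᵥ B) (x + tstep (fine n M) ν c + unitVec (fine n M) ν, μ) - (HkOp n M *ᵥ B) (x + tstep (fine n M) ν c, μ)‖
              + ‖(HkOp n M *ᵥ B) (x + tstep (fine n M) ν c, μ) - (HkOp n M *ᵥ B) (x, μ)‖ := norm_sub_le_norm_sub_add_norm_sub _ _ _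
        _ ≤ CdecD d / n * (Real.exp (dec d * c) * Φ) + c * Real.exp (dec d * c) * (CdecD d / n * Φ) :=
            add_le_add (hstep.trans (mul_le_mul_of_nonneg_left hphi hK)) ih
        _ = (c + 1) * Real.exp (dec d * c) * (CdecD d / n * Φ) := by ring
        _ ≤ ((c + 1 : ℕ) : ℝ) * Real.exp (dec d * ((c + 1 : ℕ) : ℝ)) * (CdecD d / n * Φ) := by
            push_cast
            exact mul_le_mul_of_nonneg_right (mul_le_mul_of_nonneg_left hec (by positivity)) (mul_nonneg hK hΦ0)

/-- **A CUBE VERTEX, decaying form**: `|(H_nB)_μ(x + Σ_{ν∈T} e_ν) − (H_nB)_μ(x)| ≤ |T|·e^{dec·|T|}·CdecD∕n·Φ_B(blk x)`. [folklore] -/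
theorem norm_HkOp_vtx_le_decay (B : Tor M × Fin (d + 1) → ℂ) (x : Tor (fine n M)) (μ : Fin (d + 1)) (T : Finset (Fin (d + 1))) :
    ‖(HkOp n M *ᵥ B) (x + vtx (fine n M) T, μ) - (HkOp n M *ᵥ B) (x, μ)‖
      ≤ T.card * Real.exp (dec d * T.card) *
          (CdecD d / n * ∑ y : Tor M, Real.exp (-(dec d * torusSupNorm M (rep M (blockOf n M x) - rep M y))) * ∑ lam : Fin (d + 1), ‖B (y, lam)‖) := by
  set Φ := ∑ y : Tor M, Real.exp (-(dec d * torusSupNorm M (rep M (blockOf n M x) - rep M y))) * ∑ lam : Fin (d + 1), ‖B (y, lam)‖ with hΦ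
  have hK : 0 ≤ CdecD d / n := div_nonneg CdecD_nonneg (Nat.cast_nonneg _)
  have hΦ0 : 0 ≤ Φ := Finset.sum_nonneg fun y _ => mul_nonneg (Real.exp_pos _).le (Finset.sum_nonneg fun _ _ => norm_nonneg _)
  induction T using Finset.induction_on with
  | empty => simp [vtx]
  | insert i T hi ih =>
      rw [vtx_insert _ hi, card_insert_of_notMem hi, show x + (unitVec (fine n M) i + vtx (fine n M) T) = x + vtx (fine n M) T + unitVec (fine n M) i by abel]
      have hstep := norm_HkOp_step_le_decay n M B (x + vtx (fine n M) T) μ i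
      have hphi := phi_blockOf_add_vtx_le n M B x T
      have hec : Real.exp (dec d * T.card) ≤ Real.exp (dec d * ((T.card : ℝ) + 1)) :=
        Real.exp_le_exp.mpr (mul_le_mul_of_nonneg_left (by linarith) (dec_pos d).le)
      calc ‖(HkOp n M *ᵥ B) (x + vtx (fine n M) T + unitVec (fine n M) i, μ) - (HkOp n M *ᵥ B) (x, μ)‖
          ≤ ‖(HkOp n M *ᵥ B) (x + vtx (fine n M) T + unitVec (fine n M) i, μ) - (HkOp n M *ᵥ B) (x + vtx (fine n M) T, μ)‖
              + ‖(HkOp n M *ᵥ B) (x + vtx (fine n M) T, μ) - (HkOp n M *ᵥ B) (x, μ)‖ := norm_sub_le_norm_sub_add_norm_sub _ _ _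
        _ ≤ CdecD d / n * (Real.exp (dec d * T.card) * Φ) + T.card * Real.exp (dec d * T.card) * (CdecD d / n * Φ) :=
            add_le_add (hstep.trans (mul_le_mul_of_nonneg_left hphi hK)) ih
        _ = (T.card + 1) * Real.exp (dec d * T.card) * (CdecD d / n * Φ) := by ring
        _ ≤ ((T.card + 1 : ℕ) : ℝ) * Real.exp (dec d * ((T.card + 1 : ℕ) : ℝ)) * (CdecD d / n * Φ) := by
            push_cast
            exact mul_le_mul_of_nonneg_right (mul_le_mul_of_nonneg_left hec (by positivity)) (mul_nonneg hK hΦ0)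

end Osc

end Summit.QuantumFields.BalabanUV.Beta.GAN24.HkOpBlockProfile

end
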